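import Literature.Analysis.FunctionSpaces.ContDiffMapSupportedInComplete
import Mathlib.Analysis.Distribution.ContDiffMapSupportedIn
import Mathlib.Analysis.LocallyConvex.Barrelled
import Mathlib.Analysis.Complex.Basic
import Mathlib.MeasureTheory.Integral.Bochner.Set
import Mathlib.MeasureTheory.Measure.Haar.OfBasis
import Mathlib.Topology.Baire.Lemmas
import Mathlib.Topology.Baire.CompleteMetrizable
import HarnessLib

/-!
# Ray-wise bounded pairings of a holomorphic function on a tube are uniformly bounded in
`𝒟'ᵐ` on an open cone of directions (Banach–Steinhaus and Baire)

Topic `Literature/Analysis/Distribution`. Setting (as in `BoundaryValueLimit`): `V` a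
finite-dimensional real normed space with a measure `μ`, `E` a complex normed space,
`J : V →L[ℝ] E` ("`x + iy`" is `J x + I • J y`), `f : E → ℂ` complex differentiable on an open
`U` containing the tube points `J x + I • J y`, `y ∈ Γ`, over an open set of directions `Γ`. For a
compact `K ⊆ V` the **slice pairing** at height `y`,

  `slicePairing J f μ K y : 𝓓_K(V, ℂ) →L[ℂ] ℂ`,  `F ↦ ∫ f(J x + i J y) F(x) dμ`,

is a continuous linear functional on Mathlib's space `𝓓_K = ContDiffMapSupportedIn V ℂ ⊤ K` of
smooth functions supported in `K` (`integralAgainstBilinCLM`). This file proves the two "soft"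
steps of the theorem *ray-wise distributional boundary values force locally uniform polynomial
growth* (`RayBoundaryValueGrowth`):

* `exists_seminorm_bound_of_ray_bounded` — **Banach–Steinhaus on one ray.** If for a fixed
  direction `η` every pairing `t ↦ ⟨f(· + itη), F⟩` is bounded on `t ∈ (0, 1]` (which is the case
  when the ray-wise distributional limit `t → 0⁺` exists), then there are `m` and `C` with
  `|⟨f(· + itη), F⟩| ≤ C ‖F‖_{C^m}` for all `t ∈ (0, 1]` and all `F ∈ 𝓓_K` — the distributions
  `f(· + itη)|_K` are bounded in `𝒟'ᵐ`. (`𝓓_K` is a Fréchet space — the tree's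
  `ContDiffMapSupportedInComplete` — hence barrelled, and Mathlib's uniform boundedness principle
  `WithSeminorms.banach_steinhaus` applies; `Seminorm.bound_of_continuous` extracts finitely many
  seminorms.)
* `exists_ball_seminorm_bound` — **Baire over the directions.** If this holds on every ray of the
  open set `Γ ≠ ∅`, then there are a ball of directions `B(ô, ρ₀) ⊆ Γ` and one `m` with
  `|⟨f(· + itη), F⟩| ≤ m ‖F‖_{C^m}` for all `η ∈ B(ô, ρ₀)`, `t ∈ (0, 1]`, `F ∈ 𝓓_K`: the sets
  `{η : the bound with constant and order m holds on the ray of η}` are closed (continuity of the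
  pairing in `η`) and cover a closed ball of `Γ`, a complete metric space.

Here `‖F‖_{C^m} = supSeminorm m F = max_{i ≤ m} sup ‖Dⁱ F‖` (Mathlib's
`ContDiffMapSupportedIn.supSeminorm`). The one-variable prototype of the whole theorem is
Hörmander, *The Analysis of Linear Partial Differential Operators I*, Thm. 3.1.14 ("The hypothesis
implies a uniform bound for `f(· + iy)` in `𝒟'ᵏ` when `0 < y < γ/2`" — the Banach–Steinhaus step);
the passage from ray-wise to conewise hypotheses by the Baire category theorem is standard
(cf. Schapira, *Théorie des hyperfonctions*, LNM 126, Ch. IV §3, after Martineau). [folklore]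

## Mathlib / tree

Used: `ContDiffMapSupportedIn.integralAgainstBilinCLM` (+ `_eq_integral`),
`ContDiffMapSupportedIn.withSeminorms`, `ContDiffMapSupportedIn.supSeminorm`,
`WithSeminorms.banach_steinhaus`, `WithSeminorms.uniformEquicontinuous_iff_bddAbove_and_continuous_iSup`,
`Seminorm.bound_of_continuous`, `norm_withSeminorms`, `nonempty_interior_of_iUnion_of_closed`,
`continuous_parametric_integral_of_continuous`; from the tree
`Literature.Analysis.FunctionSpaces.ContDiffMapSupportedIn.instCompleteSpace` /
`instIsCountablyGenerated_uniformity` (so that `BaireSpace.instBarrelledSpace` applies to `𝓓_K`).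
-/

noncomputable section

open MeasureTheory Metric Set Filter ContDiffMapSupportedIn
open _root_.Complex _root_.Topology
open scoped Distributions NNReal

namespace Literature.Analysis.Distribution

variable {V : Type*} [NormedAddCommGroup V] [NormedSpace ℝ V] [MeasurableSpace V] [BorelSpace V]
variable {E : Type*} [NormedAddCommGroup E] [NormedSpace ℂ E]

/-! ### The slice pairing on `𝓓_K` -/

/-- The **slice** of `f` at height `y`: `x ↦ f(J x + i J y)`. [folklore] -/
def tubeSlice (J : V →L[ℝ] E) (f : E → ℂ) (y : V) : V → ℂ := fun x => f (J x + (I : ℂ) • J y)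

/-- The **slice pairing** `F ↦ ∫ f(J x + i J y) F(x) dμ` as a continuous linear functional on the
test functions supported in the compact set `K` (Mathlib's `integralAgainstBilinCLM` for the
bilinear map `(F(x), g(x)) ↦ g(x) F(x)`; it is the zero map if the slice is not integrable on `K`,
which does not happen for slices inside the tube). [folklore] -/
def slicePairing (J : V →L[ℝ] E) (f : E → ℂ) (μ : Measure V) (K : TopologicalSpace.Compacts V)
    (y : V) : 𝓓_{K}(V, ℂ) →L[ℂ] ℂ :=
  integralAgainstBilinCLM (ContinuousLinearMap.mul ℂ ℂ).flip μ (tubeSlice J f y)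

variable {μ : Measure V} [IsFiniteMeasureOnCompacts μ]
variable {J : V →L[ℝ] E} {f : E → ℂ} {U : Set E} {Γ : Set V}

omit [MeasurableSpace V] [BorelSpace V] in
/-- The slice of a function continuous on the tube is continuous. [folklore] -/
theorem continuous_tubeSlice (hf : ContinuousOn f U) {y : V} (hy : ∀ x : V, J x + (I : ℂ) • J y ∈ U) :
    Continuous (tubeSlice J f y) :=
  hf.comp_continuous (by fun_prop) hy

/-- **The slice pairing is the integral** `∫ f(J x + i J y) F(x) dμ` when the slice lies in the
domain of continuity of `f`. [folklore] -/
theorem slicePairing_apply (hf : ContinuousOn f U) {K : TopologicalSpace.Compacts V} {y : V}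
    (hy : ∀ x : V, J x + (I : ℂ) • J y ∈ U) (F : 𝓓_{K}(V, ℂ)) :
    slicePairing J f μ K y F = ∫ x, f (J x + (I : ℂ) • J y) * F x ∂μ := by
  have hint : IntegrableOn (tubeSlice J f y) K μ :=
    (continuous_tubeSlice hf hy).continuousOn.integrableOn_compact K.isCompact
  rw [slicePairing, integralAgainstBilinCLM_eq_integral hint]
  rfl

omit [MeasurableSpace V] [BorelSpace V] in
/-- Along a ray: `J x + i J (t η) = J x + (t i) J η`. [folklore] -/
theorem tubePoint_smul (J : V →L[ℝ] E) (x η : V) (t : ℝ) :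
    J x + (I : ℂ) • J (t • η) = J x + ((t : ℂ) * I) • J η := by
  rw [J.map_smul, ← Complex.coe_smul, smul_smul, mul_comm]

/-! ### Monotonicity of the `C^m` seminorms -/

omit [MeasurableSpace V] [BorelSpace V] in
/-- The sup seminorms `‖F‖_{C^m} = max_{i ≤ m} sup ‖DⁱF‖` increase with `m`. [folklore] -/
theorem supSeminorm_mono {K : TopologicalSpace.Compacts V} {m m' : ℕ} (h : m ≤ m')
    (F : 𝓓_{K}(V, ℂ)) :
    ContDiffMapSupportedIn.supSeminorm ℂ V ℂ ⊤ K m F ≤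
      ContDiffMapSupportedIn.supSeminorm ℂ V ℂ ⊤ K m' F :=
  Seminorm.le_def.1 (Finset.sup_mono (Finset.Iic_subset_Iic.2 h)) F

omit [MeasurableSpace V] [BorelSpace V] in
/-- A finite sup of the seminorms `N_i` is dominated by `‖·‖_{C^m}` for `m = max s`. [folklore] -/
theorem finsetSup_seminorm_le_supSeminorm {K : TopologicalSpace.Compacts V} (s : Finset ℕ)
    (F : 𝓓_{K}(V, ℂ)) :
    (s.sup (ContDiffMapSupportedIn.seminorm ℂ V ℂ ⊤ K)) F ≤
      ContDiffMapSupportedIn.supSeminorm ℂ V ℂ ⊤ K (s.sup id) F := by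
  refine Seminorm.le_def.1 (Finset.sup_mono fun i hi => ?_) F
  exact Finset.mem_Iic.2 (Finset.le_sup (f := id) hi)

/-! ### Banach–Steinhaus on one ray -/

omit [IsFiniteMeasureOnCompacts μ] in
/-- **Banach–Steinhaus on one ray.** If every pairing `t ↦ ⟨f(· + i t J η), F⟩`, `F ∈ 𝓓_K`, is
bounded on `(0, 1]`, then the distributions `f(· + itJη)|_K`, `t ∈ (0, 1]`, are bounded in some
`𝒟'ᵐ`: `|⟨f(· + itJη), F⟩| ≤ C ‖F‖_{C^m}` (Hörmander, *ALPDO I*, proof of Thm. 3.1.14: "a uniform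
bound for `f(· + iy)` in `𝒟'ᵏ`"). Mathlib's uniform boundedness principle on the barrelled
(Fréchet) space `𝓓_K`. [cite: HormanderALPDO1, Thm 3.1.14 (proof)] -/
theorem exists_seminorm_bound_of_ray_bounded (K : TopologicalSpace.Compacts V) (η : V)
    (hbdd : ∀ F : 𝓓_{K}(V, ℂ), ∃ C : ℝ, ∀ t ∈ Ioc (0 : ℝ) 1,
      ‖slicePairing J f μ K (t • η) F‖ ≤ C) :
    ∃ (m : ℕ) (C : ℝ), ∀ t ∈ Ioc (0 : ℝ) 1, ∀ F : 𝓓_{K}(V, ℂ),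
      ‖slicePairing J f μ K (t • η) F‖ ≤
        C * ContDiffMapSupportedIn.supSeminorm ℂ V ℂ ⊤ K m F := by
  -- the family of functionals indexed by `t ∈ (0, 1]`
  set 𝓕 : Ioc (0 : ℝ) 1 → 𝓓_{K}(V, ℂ) →L[ℂ] ℂ := fun t => slicePairing J f μ K ((t : ℝ) • η)
    with h𝓕
  have hq := norm_withSeminorms ℂ ℂ
  have H : ∀ (_ : Fin 1) (F : 𝓓_{K}(V, ℂ)),
      BddAbove (range fun t : Ioc (0 : ℝ) 1 => normSeminorm ℂ ℂ (𝓕 t F)) := by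
    intro _ F
    obtain ⟨C, hC⟩ := hbdd F
    exact ⟨C, by rintro _ ⟨t, rfl⟩; exact hC t t.2⟩
  have hequi : UniformEquicontinuous ((↑) ∘ 𝓕) := hq.banach_steinhaus H
  have hequi' : UniformEquicontinuous
      ((↑) ∘ fun t : Ioc (0 : ℝ) 1 => ((𝓕 t : 𝓓_{K}(V, ℂ) →L[ℂ] ℂ) : 𝓓_{K}(V, ℂ) →ₗ[ℂ] ℂ)) :=
    hequi
  obtain ⟨hB, hcont⟩ := (hq.uniformEquicontinuous_iff_bddAbove_and_continuous_iSup
    (fun t : Ioc (0 : ℝ) 1 => ((𝓕 t : 𝓓_{K}(V, ℂ) →L[ℂ] ℂ) : 𝓓_{K}(V, ℂ) →ₗ[ℂ] ℂ))).1 hequi' 0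
  -- the continuous seminorm `Q = ⨆ₜ ‖𝓕 t ·‖` is dominated by finitely many `N_i`
  set Q : Seminorm ℂ 𝓓_{K}(V, ℂ) := ⨆ t : Ioc (0 : ℝ) 1,
    (normSeminorm ℂ ℂ).comp ((𝓕 t : 𝓓_{K}(V, ℂ) →L[ℂ] ℂ) : 𝓓_{K}(V, ℂ) →ₗ[ℂ] ℂ) with hQ
  have hQc : Continuous Q := by
    have hcoe : (⇑Q : 𝓓_{K}(V, ℂ) → ℝ) = ⨆ t : Ioc (0 : ℝ) 1, ⇑((normSeminorm ℂ ℂ).comp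
        ((𝓕 t : 𝓓_{K}(V, ℂ) →L[ℂ] ℂ) : 𝓓_{K}(V, ℂ) →ₗ[ℂ] ℂ)) := Seminorm.coe_iSup_eq hB
    rw [hcoe]; exact hcont
  obtain ⟨s, C, -, hle⟩ := Seminorm.bound_of_continuous
    (ContDiffMapSupportedIn.withSeminorms ℂ V ℂ ⊤ K) Q hQc
  refine ⟨s.sup id, C, fun t ht F => ?_⟩
  have h1 : ‖slicePairing J f μ K (t • η) F‖ ≤ Q F := by
    have hle' : (normSeminorm ℂ ℂ).comp
        ((𝓕 ⟨t, ht⟩ : 𝓓_{K}(V, ℂ) →L[ℂ] ℂ) : 𝓓_{K}(V, ℂ) →ₗ[ℂ] ℂ) ≤ Q := le_ciSup hB ⟨t, ht⟩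
    exact hle' F
  have h2 : Q F ≤ C * (s.sup (ContDiffMapSupportedIn.seminorm ℂ V ℂ ⊤ K)) F := hle F
  exact h1.trans (h2.trans (mul_le_mul_of_nonneg_left (finsetSup_seminorm_le_supSeminorm s F)
    C.2))

/-! ### Continuity of the pairing in the direction -/

/-- The pairing `η ↦ ⟨f(· + i J η), F⟩` is continuous on the set of directions whose slices lie in
the domain of continuity of `f` (parametric integral with continuous integrand supported in the
compact set `K`). [folklore] -/
theorem continuousOn_slicePairing [FiniteDimensional ℝ V] (hf : ContinuousOn f U) (hΓo : IsOpen Γ)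
    (htube : ∀ x : V, ∀ y ∈ Γ, J x + (I : ℂ) • J y ∈ U) (K : TopologicalSpace.Compacts V)
    (F : 𝓓_{K}(V, ℂ)) :
    ContinuousOn (fun η : V => slicePairing J f μ K η F) Γ := by
  -- work on the open subtype `Γ`
  have key : Continuous fun η : Γ => slicePairing J f μ K (η : V) F := by
    have heq : (fun η : Γ => slicePairing J f μ K (η : V) F) =
        fun η : Γ => ∫ x in (K : Set V), f (J x + (I : ℂ) • J (η : V)) * F x ∂μ := by
      funext η
      rw [slicePairing_apply hf (fun x => htube x _ η.2),
        setIntegral_eq_integral_of_forall_compl_eq_zero]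
      intro x hx
      rw [F.zero_on_compl hx, Pi.zero_apply, mul_zero]
    rw [heq]
    haveI : LocallyCompactSpace Γ := hΓo.locallyCompactSpace
    refine continuous_parametric_integral_of_continuous ?_ K.isCompact
    refine Continuous.mul ?_ (F.continuous.comp continuous_snd)
    refine hf.comp_continuous (by fun_prop) fun p => htube _ _ p.1.2
  rw [continuousOn_iff_continuous_restrict]
  exact key

/-! ### Baire over the directions -/

omit [MeasurableSpace V] [BorelSpace V] in
/-- Small ball inside two balls: for `η₁` in the closed ball `B̄(η₀, δ)` and `ρ > 0` there is a
ball `B(ô, ρ₀)` contained in both `B(η₁, ρ)` and the open ball `B(η₀, δ)`. [folklore] -/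
theorem exists_ball_subset_ball_inter {η₀ η₁ : V} {δ ρ : ℝ} (hδ : 0 < δ) (hρ : 0 < ρ)
    (h₁ : η₁ ∈ closedBall η₀ δ) :
    ∃ (ô : V) (ρ₀ : ℝ), 0 < ρ₀ ∧ ball ô ρ₀ ⊆ ball η₁ ρ ∧ ball ô ρ₀ ⊆ ball η₀ δ := by
  set s : ℝ := min (1 / 2) (ρ / (2 * δ + 1)) with hs
  have hs0 : 0 < s := by positivity
  have hs1 : s ≤ 1 / 2 := min_le_left _ _
  have hsρ : s * δ ≤ ρ / 2 := by
    have h := min_le_right (1 / 2 : ℝ) (ρ / (2 * δ + 1))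
    rw [le_div_iff₀ (by positivity)] at h
    nlinarith
  rw [mem_closedBall, dist_eq_norm] at h₁
  refine ⟨η₁ + s • (η₀ - η₁), s * δ, by positivity, fun y hy => ?_, fun y hy => ?_⟩
  · rw [mem_ball] at hy ⊢
    have hd : dist (η₁ + s • (η₀ - η₁)) η₁ ≤ s * δ := by
      rw [dist_eq_norm, add_sub_cancel_left, norm_smul, Real.norm_eq_abs, abs_of_pos hs0,
        norm_sub_rev]
      exact mul_le_mul_of_nonneg_left h₁ hs0.le
    calc dist y η₁ ≤ dist y (η₁ + s • (η₀ - η₁)) + dist (η₁ + s • (η₀ - η₁)) η₁ :=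
          dist_triangle _ _ _
      _ < s * δ + s * δ := add_lt_add_of_lt_of_le hy hd
      _ ≤ ρ := by linarith
  · rw [mem_ball] at hy ⊢
    have hd : dist (η₁ + s • (η₀ - η₁)) η₀ ≤ (1 - s) * δ := by
      rw [dist_eq_norm, show η₁ + s • (η₀ - η₁) - η₀ = (1 - s) • (η₁ - η₀) by module, norm_smul,
        Real.norm_eq_abs, abs_of_pos (by linarith)]
      exact mul_le_mul_of_nonneg_left h₁ (by linarith)
    calc dist y η₀ ≤ dist y (η₁ + s • (η₀ - η₁)) + dist (η₁ + s • (η₀ - η₁)) η₀ :=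
          dist_triangle _ _ _
      _ < s * δ + (1 - s) * δ := add_lt_add_of_lt_of_le hy hd
      _ = δ := by ring

/-- **Baire over the directions.** Let `Γ` be an open non-empty cone, with all slices over `Γ` in
the domain `U` of holomorphy (continuity suffices here) of `f`. If on every ray `{tη : 0 < t ≤ 1}`,
`η ∈ Γ`, the pairings are bounded by `C(η) ‖F‖_{C^{m(η)}}`, then there are a ball of directions
`B(ô, ρ₀) ⊆ Γ` and one `m` with `|⟨f(· + itJη), F⟩| ≤ m ‖F‖_{C^m}` for all `η ∈ B(ô, ρ₀)`,
`t ∈ (0, 1]`, `F ∈ 𝓓_K`. Proof: the sets `S_m = {η : the bound (m, m) holds on the ray of η}` are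
closed in a closed ball `D ⊆ Γ` and cover it; `D` is a complete metric space, so some `S_m` has
an interior point (Baire). [folklore] -/
theorem exists_ball_seminorm_bound [FiniteDimensional ℝ V] (hf : ContinuousOn f U) (hΓo : IsOpen Γ)
    (hΓcone : ∀ c : ℝ, 0 < c → ∀ y ∈ Γ, c • y ∈ Γ) (hΓne : Γ.Nonempty)
    (htube : ∀ x : V, ∀ y ∈ Γ, J x + (I : ℂ) • J y ∈ U) (K : TopologicalSpace.Compacts V)
    (hray : ∀ η ∈ Γ, ∃ (m : ℕ) (C : ℝ), ∀ t ∈ Ioc (0 : ℝ) 1, ∀ F : 𝓓_{K}(V, ℂ),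
      ‖slicePairing J f μ K (t • η) F‖ ≤ C * ContDiffMapSupportedIn.supSeminorm ℂ V ℂ ⊤ K m F) :
    ∃ (ô : V) (ρ₀ : ℝ) (m : ℕ), 0 < ρ₀ ∧ ball ô ρ₀ ⊆ Γ ∧
      ∀ η ∈ ball ô ρ₀, ∀ t ∈ Ioc (0 : ℝ) 1, ∀ F : 𝓓_{K}(V, ℂ),
        ‖slicePairing J f μ K (t • η) F‖ ≤ m * ContDiffMapSupportedIn.supSeminorm ℂ V ℂ ⊤ K m F := by
  classical
  -- a closed ball `D ⊆ Γ`
  obtain ⟨η₀, hη₀⟩ := hΓne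
  obtain ⟨δ, hδ, hδΓ⟩ := Metric.isOpen_iff.1 hΓo η₀ hη₀
  set D : Set V := closedBall η₀ (δ / 2) with hD
  have hDΓ : D ⊆ Γ := (closedBall_subset_ball (by linarith)).trans hδΓ
  haveI : CompleteSpace D := (isClosed_closedBall (x := η₀) (ε := δ / 2)).completeSpace_coe
  haveI : Nonempty D := ⟨⟨η₀, mem_closedBall_self (by linarith)⟩⟩
  -- the closed sets `S m`
  set P : ℕ → ℝ → 𝓓_{K}(V, ℂ) → V → Prop := fun m t F η =>
    ‖slicePairing J f μ K (t • η) F‖ ≤ m * ContDiffMapSupportedIn.supSeminorm ℂ V ℂ ⊤ K m F with hP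
  set S : ℕ → Set D := fun m => {η | ∀ t ∈ Ioc (0 : ℝ) 1, ∀ F : 𝓓_{K}(V, ℂ), P m t F (η : V)}
    with hS
  have hclosed : ∀ m, IsClosed (S m) := by
    intro m
    have : S m = ⋂ t ∈ Ioc (0 : ℝ) 1, ⋂ F : 𝓓_{K}(V, ℂ), {η : D | P m t F (η : V)} := by
      ext η; simp [hS]
    rw [this]
    refine isClosed_biInter fun t ht => isClosed_iInter fun F => ?_
    refine isClosed_le (continuous_norm.comp ?_) continuous_const
    exact (continuousOn_slicePairing (μ := μ) hf hΓo htube K F).comp_continuous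
      (continuous_const.smul continuous_subtype_val) fun η => hΓcone t ht.1 _ (hDΓ η.2)
  have hcover : (⋃ m, S m) = univ := by
    refine eq_univ_of_forall fun η => mem_iUnion.2 ?_
    obtain ⟨m₀, C, hC⟩ := hray η (hDΓ η.2)
    refine ⟨max m₀ ⌈C⌉₊, fun t ht F => ?_⟩
    have h0 : 0 ≤ ContDiffMapSupportedIn.supSeminorm ℂ V ℂ ⊤ K m₀ F := apply_nonneg _ _
    have hCm : C ≤ (max m₀ ⌈C⌉₊ : ℕ) := (Nat.le_ceil C).trans (by exact_mod_cast le_max_right _ _)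
    calc ‖slicePairing J f μ K (t • (η : V)) F‖ ≤ C * ContDiffMapSupportedIn.supSeminorm ℂ V ℂ ⊤ K m₀ F :=
          hC t ht F
      _ ≤ (max m₀ ⌈C⌉₊ : ℕ) * ContDiffMapSupportedIn.supSeminorm ℂ V ℂ ⊤ K m₀ F :=
          mul_le_mul_of_nonneg_right hCm h0
      _ ≤ (max m₀ ⌈C⌉₊ : ℕ) * ContDiffMapSupportedIn.supSeminorm ℂ V ℂ ⊤ K (max m₀ ⌈C⌉₊) F :=
          mul_le_mul_of_nonneg_left (supSeminorm_mono (le_max_left _ _) F) (Nat.cast_nonneg _)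
  -- Baire
  obtain ⟨m, η₁, hη₁⟩ := nonempty_interior_of_iUnion_of_closed hclosed hcover
  obtain ⟨ρ, hρ, hball⟩ := Metric.mem_nhds_iff.1 (mem_interior_iff_mem_nhds.1 hη₁)
  obtain ⟨ô, ρ₀, hρ₀, hsub₁, hsub₀⟩ :=
    exists_ball_subset_ball_inter (half_pos hδ) hρ (η₁.2 : (η₁ : V) ∈ closedBall η₀ (δ / 2))
  refine ⟨ô, ρ₀, m, hρ₀, hsub₀.trans ((ball_subset_ball (by linarith)).trans hδΓ), ?_⟩
  intro η hη t ht F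
  have hηD : η ∈ D := ball_subset_closedBall (hsub₀ hη)
  have hmem : (⟨η, hηD⟩ : D) ∈ S m := by
    refine hball ?_
    rw [mem_ball, Subtype.dist_eq]
    exact hsub₁ hη
  exact hmem t ht F

end Literature.Analysis.Distribution
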